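import Literature.Geometry.Kaehler.HolomorphicChainSliceRectifiable
import Literature.Geometry.Kaehler.HolomorphicChainBlowUpPiece
import Literature.Geometry.Kaehler.BlowUpDefectPieces
import HarnessLib

/-!
# Integral ball pieces of a holomorphic chain, with uniform normal mass along a sequence

Layer `Literature/Geometry/Kaehler`; lane `lit-hodgefound`, programme «CHAIN COMPACTNESS», file F2
— the technical input of the compactness theorem for holomorphic chains
[Chirka1989, §16.1 Prop. 1, pp. 206–207]: to apply the Federer–Fleming closure theorem
(`Literature.Geometry.GeometricMeasureTheory.Current.isRectifiable_of_tendsto_integral`) to a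
weakly convergent sequence of holomorphic `p`-chains `T_j` (`p = q + 1`) with locally bounded
masses one cuts each `[T_j]` down to a ball `B(c, ρ_j)` at a GOOD radius, obtaining INTEGRAL
currents on the whole space with uniformly bounded normal mass.

For a holomorphic `p`-chain `T` on an open `Ω ⊆ V` and a ball `B(c, ρ)`, the **ball piece**

`T.piece c ρ = [reg|T| ∩ B(c,ρ), θ_T, ξ_T] ∈ 𝒟_{2p}(V)`   (`HolomorphicChain.piece`)

is the current of integration over the part of the carrier in the ball, read on all of `V`.
When `B̄(c, ρ) ⊆ Ω`:

* `isRectifiableData_piece`, `isRectifiable_piece`, `support_piece_subset`, `mass_piece_eq` —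
  admissible data on `V`, compact support in `B̄(c,ρ)`, `𝐌 = ∫_{reg|T| ∩ B(c,ρ)} |θ_T| d𝓗^{2p}`;
* `piece_monoCLM_apply` — `T.piece c ρ` agrees with `[T]` on test forms supported in `B(c,ρ)`;
* `mass_boundary_piece_le_mass_slice` — `𝐌(∂ piece) ≤ 𝐌⟨[T]|B(c,t₂), -‖·-c‖², -ρ²⟩` (the
  boundary of the piece is read on the ball `B(c,t₂) ⊃ B̄(c,ρ)`, where it is minus the slice,
  `[T]` being a cycle [Harvey1977, Lemma 1.8]);
* `exists_piece_isIntegral_mass_boundary_le` — **a good radius**: if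
  `∫_{reg|T| ∩ B̄(c,t₂)} |θ_T| ≤ M` and `0 < ρ₁ < ρ₂ < t₂`, some `ρ ∈ (ρ₁, ρ₂)` makes
  `T.piece c ρ` an INTEGRAL current with `𝐌(∂ piece) ≤ Λ := (C_{2q+1}·2t₂·M + 1)/(ρ₂² - ρ₁²)`
  (sphere slices are rectifiable for a.e. radius, `HolomorphicChain.ae_exists_sphereSliceData`;
  the slicing inequality `∫ 𝐌⟨X, f, s⟩ ds ≤ C ∫ ‖Df‖ d‖X‖` [Federer1969, 4.2.1] and Chebyshev
  on the conull set of good levels);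
* `exists_seq_piece_isIntegral` — **the sequence form**: for holomorphic `p`-chains `T_j` with
  `∫_{reg|T_j| ∩ B̄(c,t₂)} |θ_{T_j}| ≤ M` for all `j`, radii `ρ_j ∈ (ρ₁, ρ₂)` with `T_j.piece c ρ_j`
  integral, supported in `B̄(c, ρ₂)`, of normal mass `≤ M + Λ`, agreeing with `[T_j]` on forms
  supported in `B(c, ρ₁)`.

One definition with body (`HolomorphicChain.piece`), theorems; no named facts.

## References

* [Chirka1989] E. M. Chirka, *Complex Analytic Sets*, Kluwer 1989, §16.1 Prop. 1, pp. 206–207.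
* [Federer1969] H. Federer, *Geometric Measure Theory*, Springer 1969, 4.1.7, 4.1.24, 4.2.1,
  4.2.16–4.2.17.
* [Harvey1977] R. Harvey, *Holomorphic chains and their boundaries*, PSPUM XXX.1 (1977),
  Lemma 1.8, §2.1.
-/

noncomputable section

open scoped Manifold Topology ENNReal NNReal ContDiff
open Set Filter MeasureTheory Metric Function TopologicalSpace

namespace Literature.Geometry.Kaehler

open Literature.Geometry.GeometricMeasureTheory

-- Nested operator-norm instances on (duals of) `V [⋀^Fin n]→L[ℝ] ℝ`.
set_option maxSynthPendingDepth 2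

namespace HolomorphicChain

universe u

variable {V : Type u} [NormedAddCommGroup V] [InnerProductSpace ℂ V] [FiniteDimensional ℂ V]
  [MeasurableSpace V] [BorelSpace V] {Ω : Opens V} {p q : ℕ}

/-! ### The ball pieces -/

/-- **The ball piece `[reg|T| ∩ B(c,ρ), θ_T, ξ_T]` of the current of a holomorphic chain**, read
as a current on the whole space `V` (Federer's `([T] ⌞ B(c,ρ))` extended by zero).
[cite: Federer1969, 4.1.7; Chirka1989, §16.1, p. 206] -/
def piece (T : HolomorphicChain 𝓘(ℂ, V) Ω p) (c : V) (ρ : ℝ) : Current (⊤ : Opens V) (2 * p) :=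
  currentOfIntegration (T.carrier ∩ ball c ρ) T.density T.orientationFrame

omit [FiniteDimensional ℂ V] in
/-- Unfolding lemma for `piece`: `T.piece c ρ = [reg|T| ∩ B(c,ρ), θ_T, ξ_T]`.
[cite: Federer1969, 4.1.7] -/
theorem piece_def (T : HolomorphicChain 𝓘(ℂ, V) Ω p) (c : V) (ρ : ℝ) :
    T.piece c ρ = currentOfIntegration (T.carrier ∩ ball c ρ) T.density T.orientationFrame := rfl

/-- **The ball piece has admissible rectifiable data on `V`** (`B̄(c,ρ) ⊆ Ω`): Harvey's data of
`[T]` cut down to the ball, a closed subset of `Ω`. [cite: Harvey1977, §2.1 (2.2); Federer1969, 4.1.28] -/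
theorem isRectifiableData_piece (T : HolomorphicChain 𝓘(ℂ, V) Ω p) {c : V} {ρ : ℝ}
    (hB : closedBall c ρ ⊆ (Ω : Set V)) :
    letI : InnerProductSpace ℝ V := InnerProductSpace.complexToReal
    IsRectifiableData (⊤ : Opens V) (2 * p) (T.carrier ∩ ball c ρ) T.density T.orientationFrame := by
  letI : InnerProductSpace ℝ V := InnerProductSpace.complexToReal
  exact ((Harvey1977_isRectifiableData_toCurrent_holds V Ω p T).inter measurableSet_ball).to_top
    (inter_subset_right.trans ball_subset_closedBall) isClosed_closedBall hB

omit [FiniteDimensional ℂ V] in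
/-- **`spt (T.piece c ρ) ⊆ B̄(c,ρ)`.** [cite: Federer1969, 4.1.1] -/
theorem support_piece_subset (T : HolomorphicChain 𝓘(ℂ, V) Ω p) (c : V) (ρ : ℝ) :
    (T.piece c ρ).support ⊆ closedBall c ρ :=
  (support_currentOfIntegration_subset_closure _ _ _).trans
    (closure_minimal (inter_subset_right.trans ball_subset_closedBall) isClosed_closedBall)

/-- **The ball piece is a rectifiable current** (`B̄(c,ρ) ⊆ Ω`): admissible data and compact
support. [cite: Federer1969, 4.1.24, 4.1.28] -/
theorem isRectifiable_piece (T : HolomorphicChain 𝓘(ℂ, V) Ω p) {c : V} {ρ : ℝ}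
    (hB : closedBall c ρ ⊆ (Ω : Set V)) :
    letI : InnerProductSpace ℝ V := InnerProductSpace.complexToReal
    (T.piece c ρ).IsRectifiable := by
  letI : InnerProductSpace ℝ V := InnerProductSpace.complexToReal
  haveI : FiniteDimensional ℝ V := FiniteDimensional.complexToReal V
  exact ⟨⟨_, _, _, T.isRectifiableData_piece hB, rfl⟩,
    Current.isCompact_support_of_subset _ (isCompact_closedBall c ρ) (subset_univ _)
      (T.support_piece_subset c ρ)⟩

/-- **Mass of the ball piece**: `𝐌(T.piece c ρ) = ∫_{reg|T| ∩ B(c,ρ)} |θ_T| d𝓗^{2p}`.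
[cite: Federer1969, 4.1.28 (4)] -/
theorem mass_piece_eq (T : HolomorphicChain 𝓘(ℂ, V) Ω p) {c : V} {ρ : ℝ}
    (hB : closedBall c ρ ⊆ (Ω : Set V)) :
    (T.piece c ρ).mass =
      ∫⁻ x in T.carrier ∩ ball c ρ, ‖(T.density x : ℝ)‖ₑ ∂(μHE[2 * p] : Measure V) := by
  letI : InnerProductSpace ℝ V := InnerProductSpace.complexToReal
  exact (T.isRectifiableData_piece hB).mass_eq

/-- **Mass bound for the ball piece** by the mass of `[T]` on the closed ball:
`𝐌(T.piece c ρ) ≤ ∫_{reg|T| ∩ B̄(c,t₂)} |θ_T| d𝓗^{2p}` for `ρ ≤ t₂`. [cite: Federer1969, 4.1.7] -/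
theorem mass_piece_le (T : HolomorphicChain 𝓘(ℂ, V) Ω p) {c : V} {ρ t₂ : ℝ} (hρ : ρ ≤ t₂)
    (hB : closedBall c t₂ ⊆ (Ω : Set V)) :
    (T.piece c ρ).mass ≤
      ∫⁻ x in T.carrier ∩ closedBall c t₂, ‖(T.density x : ℝ)‖ₑ ∂(μHE[2 * p] : Measure V) := by
  rw [T.mass_piece_eq ((closedBall_subset_closedBall hρ).trans hB)]
  exact lintegral_mono_set (inter_subset_inter_right _
    (ball_subset_closedBall.trans (closedBall_subset_closedBall hρ)))

/-- The mass of the ball piece is finite (Lelong). [cite: Chirka1989, §14.1 Thm.] -/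
theorem mass_piece_lt_top (T : HolomorphicChain 𝓘(ℂ, V) Ω p) {c : V} {ρ : ℝ}
    (hB : closedBall c ρ ⊆ (Ω : Set V)) : (T.piece c ρ).mass < ⊤ := by
  rw [T.mass_piece_eq hB]
  exact lt_of_le_of_lt (lintegral_mono_set (inter_subset_inter_right _ ball_subset_closedBall))
    (T.lintegral_enorm_density_inter_lt_top (isCompact_closedBall c ρ) hB)

/-- **The ball piece agrees with `[T]` on test forms supported in the ball** (`B̄(c,ρ) ⊆ Ω`):
`(T.piece c ρ)(ψ) = [T](ψ)` for `spt ψ ⊆ B(c,ρ)` (read `ψ` on `V` by extension by zero).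
[cite: Federer1969, 4.1.7] -/
theorem piece_monoCLM_apply (T : HolomorphicChain 𝓘(ℂ, V) Ω p) {c : V} {ρ : ℝ}
    (hB : closedBall c ρ ⊆ (Ω : Set V)) (ψ : TestForm Ω (2 * p)) (hψ : tsupport ⇑ψ ⊆ ball c ρ) :
    T.piece c ρ (TestFunction.monoCLM ℝ ψ) = T.toCurrent ψ := by
  letI : InnerProductSpace ℝ V := InnerProductSpace.complexToReal
  have hT := Harvey1977_isRectifiableData_toCurrent_holds V Ω p T
  have hd := T.isRectifiableData_piece hB
  have hle : Ω ≤ (⊤ : Opens V) := le_top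
  have h1 : T.piece c ρ (TestFunction.monoCLM ℝ ψ) =
      (currentOfIntegration (T.carrier ∩ ball c ρ) T.density T.orientationFrame :
        Current Ω (2 * p)) ψ := by
    rw [piece, currentOfIntegration_eq_comp_monoCLM hle hd.2.2.2.1]
    rfl
  rw [h1, toCurrent_def,
    currentOfIntegration_apply_eq_inter_of_tsupport_subset hT.1 hT.2.2.2.1 ψ hψ]

/-! ### The boundary of a ball piece and the slices of `[T]` -/

section Boundary

variable (T : HolomorphicChain 𝓘(ℂ, V) Ω (q + 1)) {c : V} {t₂ : ℝ}

/-- The open ball `B(c,t₂)` as an open subset of `V` (plumbing). [folklore] -/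
private abbrev U₀ (c : V) (t₂ : ℝ) : Opens V := ⟨ball c t₂, isOpen_ball⟩

/-- The slicing function `f = -‖· - c‖²`, whose superlevel sets `{s < f}` are the balls
`B(c, √(-s))` (plumbing, as in `HolomorphicChainSliceRectifiable`). [folklore] -/
private def sf (c : V) : V → ℝ := fun y => -‖y - c‖ ^ 2

omit [FiniteDimensional ℂ V] [MeasurableSpace V] [BorelSpace V] in
/-- The slicing function is smooth. [folklore] -/
private theorem sf_contDiff (c : V) : ContDiff ℝ ∞ (sf c) :=
  ((contDiff_norm_sq ℂ).comp (contDiff_id.sub contDiff_const)).neg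

omit [InnerProductSpace ℂ V] [FiniteDimensional ℂ V] [MeasurableSpace V] [BorelSpace V] in
/-- `{s < f} = B(c, √(-s))`. [folklore] -/
private theorem setOf_lt_sf_eq_ball (c : V) (s : ℝ) : {y : V | s < sf c y} = ball c (Real.sqrt (-s)) :=
  setOf_lt_neg_norm_sub_sq_eq_ball c s

omit [FiniteDimensional ℂ V] [MeasurableSpace V] [BorelSpace V] in
/-- `‖Df(x)‖ = 2‖x - c‖`. [folklore] -/
private theorem norm_fderiv_sf (c x : V) : ‖fderiv ℝ (sf c) x‖ = 2 * ‖x - c‖ :=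
  norm_fderiv_neg_norm_sub_sq c x

/-- `[T]|B(c,t₂) = [reg|T| ∩ B(c,t₂), θ_T, ξ_T]`, read as a current on the ball `B(c,t₂)`
(plumbing). [folklore] -/
private abbrev cut (T : HolomorphicChain 𝓘(ℂ, V) Ω (q + 1)) (c : V) (t₂ : ℝ) :
    Current (U₀ c t₂) (2 * q + 1 + 1) :=
  currentOfIntegration (T.carrier ∩ ball c t₂) T.density
    (T.orientationFrame : V → Fin (2 * q + 1 + 1) → V)

/-- `[T]` cut down to the ball `B(c,t₂) ⊆ Ω`, as a current on that ball: admissible data, a cycle,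
of mass `≤ ∫_{reg|T| ∩ B̄(c,t₂)} |θ_T|`. [cite: Harvey1977, Lemma 1.8; Chirka1989, §14.1] -/
private theorem cut_spec (hB : closedBall c t₂ ⊆ (Ω : Set V)) :
    letI : InnerProductSpace ℝ V := InnerProductSpace.complexToReal
    ∃ (_ : IsRectifiableData (U₀ c t₂) (2 * q + 1 + 1) (T.carrier ∩ ball c t₂) T.density
        (T.orientationFrame : V → Fin (2 * q + 1 + 1) → V)),
      Current.boundary (T.cut c t₂) = 0 ∧
      (T.cut c t₂).mass ≤
        ∫⁻ x in T.carrier ∩ closedBall c t₂, ‖(T.density x : ℝ)‖ₑ ∂(μHE[2 * (q + 1)] : Measure V) := by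
  letI : InnerProductSpace ℝ V := InnerProductSpace.complexToReal
  have hU₀Ω : U₀ c t₂ ≤ Ω := fun x hx => hB (ball_subset_closedBall hx)
  have hTΩ := Harvey1977_isRectifiableData_toCurrent_holds V Ω (q + 1) T
  have hd₀ : IsRectifiableData (U₀ c t₂) (2 * (q + 1)) (T.carrier ∩ ((U₀ c t₂ : Opens V) : Set V))
      T.density T.orientationFrame := hTΩ.inter_of_le hU₀Ω
  refine ⟨hd₀, ?_, ?_⟩
  · have hXeq : (T.cut c t₂) =
        (currentOfIntegration T.carrier T.density
          (T.orientationFrame : V → Fin (2 * q + 1 + 1) → V) : Current (U₀ c t₂) (2 * q + 1 + 1)) :=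
      currentOfIntegration_inter_eq_of_le hTΩ.1 hU₀Ω hTΩ.2.2.2.1
    rw [hXeq]
    exact currentOfIntegration_boundary_eq_zero_of_le hU₀Ω hTΩ.2.2.2.1
      (Harvey1977_boundary_toCurrent_eq_zero_holds V Ω q T)
  · have h1 : (T.cut c t₂).mass =
        ∫⁻ x in T.carrier ∩ ball c t₂, ‖(T.density x : ℝ)‖ₑ ∂(μHE[2 * q + 1 + 1] : Measure V) :=
      hd₀.mass_eq
    rw [h1]
    exact lintegral_mono_set (inter_subset_inter_right _ ball_subset_closedBall)

/-- **The boundary mass of a ball piece is at most the mass of the corresponding slice of `[T]`.**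
For `B̄(c,t₂) ⊆ Ω` and `s ∈ (-t₂², 0)`, `ρ = √(-s)`: with `X = [T]|B(c,t₂)` (a representable cycle
on the ball) and `f = -‖· - c‖²`, one has `X ⌞ {s < f} = [reg|T| ∩ B(c,ρ)]`, whose boundary on the
ball is `-⟨X, f, s+⟩`; and the boundary mass of the piece on `V` (supported in `B̄(c,ρ)`) is at most
its boundary mass read on the ball. [cite: Federer1969, 4.2.1, 4.1.7] -/
private theorem mass_boundary_piece_le_mass_slice (ht₂ : 0 < t₂) (hB : closedBall c t₂ ⊆ (Ω : Set V))
    {s : ℝ} (hs : s ∈ Ioo (-t₂ ^ 2) 0)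
    (hX : letI : InnerProductSpace ℝ V := InnerProductSpace.complexToReal
      (T.cut c t₂).IsRepresentable)
    (hdX : letI : InnerProductSpace ℝ V := InnerProductSpace.complexToReal
      (Current.boundary (T.cut c t₂)).IsRepresentable)
    (h0X : letI : InnerProductSpace ℝ V := InnerProductSpace.complexToReal
      Current.boundary (T.cut c t₂) = 0) :
    letI : InnerProductSpace ℝ V := InnerProductSpace.complexToReal
    (Current.boundary (T.piece c (Real.sqrt (-s)) : Current (⊤ : Opens V) (2 * q + 1 + 1))).mass ≤
      (hX.slice hdX (sf_contDiff c).continuous s).mass := by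
  letI : InnerProductSpace ℝ V := InnerProductSpace.complexToReal
  haveI : FiniteDimensional ℝ V := FiniteDimensional.complexToReal V
  obtain ⟨hd₀, -, -⟩ := T.cut_spec hB
  -- the radius
  set ρ : ℝ := Real.sqrt (-s) with hρ
  have hρt : ρ < t₂ := by rw [hρ, Real.sqrt_lt' ht₂]; linarith [hs.1]
  have hρ0 : 0 < ρ := Real.sqrt_pos.2 (by linarith [hs.2])
  -- `X ⌞ {s < f} = [reg|T| ∩ B(c,ρ)]` on the ball
  have hEm : MeasurableSet {y : V | s < sf c y} :=
    measurableSet_lt_of_continuous (sf_contDiff c).continuous s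
  have hset : T.carrier ∩ ball c t₂ ∩ {y | s < sf c y} = T.carrier ∩ ball c ρ := by
    rw [inter_assoc, setOf_lt_sf_eq_ball c s, inter_eq_right.2 (ball_subset_ball hρt.le)]
  have hres : hX.restrictSet {y | s < sf c y} hEm =
      (currentOfIntegration (T.carrier ∩ ball c ρ) T.density
        (T.orientationFrame : V → Fin (2 * q + 1 + 1) → V) : Current (U₀ c t₂) (2 * q + 1 + 1)) := by
    have h1 := hd₀.restrictSet_eq hEm
    rw [hset] at h1
    exact h1
  -- the piece restricted to the ball
  have hle : U₀ c t₂ ≤ (⊤ : Opens V) := le_top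
  have hdρ := T.isRectifiableData_piece ((closedBall_subset_closedBall hρt.le).trans hB)
  have hcomp : ((T.piece c ρ : Current (⊤ : Opens V) (2 * q + 1 + 1)).comp
      (TestFunction.monoCLM ℝ) : Current (U₀ c t₂) (2 * q + 1 + 1)) =
      hX.restrictSet {y | s < sf c y} hEm := by
    rw [hres, piece, ← currentOfIntegration_eq_comp_monoCLM hle hdρ.2.2.2.1]
  -- a cutoff `≡ 1` near `B̄(c,ρ)` supported in the ball `B(c,t₂)`
  obtain ⟨ρ', hρρ', hρ't⟩ := exists_between hρt
  set χ : ContDiffBump c := ⟨ρ', (ρ' + t₂) / 2, hρ0.trans hρρ', by linarith⟩ with hχdef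
  have hχ1 : ∀ x ∈ ball c ρ', (χ : V → ℝ) x = 1 := fun x hx =>
    χ.one_of_mem_closedBall (ball_subset_closedBall hx)
  have hχsupp : tsupport (χ : V → ℝ) ⊆ ((U₀ c t₂ : Opens V) : Set V) := by
    rw [χ.tsupport_eq]
    exact closedBall_subset_ball (by show (ρ' + t₂) / 2 < t₂; linarith)
  have hχabs : ∀ x, |(χ : V → ℝ) x| ≤ 1 := fun x => by
    rw [abs_of_nonneg (χ.nonneg' x)]; exact χ.le_one
  have key := Current.mass_boundary_le_of_comp_monoCLM (Ω' := U₀ c t₂)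
    (T.piece c ρ : Current (⊤ : Opens V) (2 * q + 1 + 1)) isOpen_ball
    ((T.support_piece_subset c ρ).trans (closedBall_subset_ball hρρ')) χ.contDiff
    χ.hasCompactSupport hχsupp hχ1 hχabs
  rw [hcomp, hX.boundary_restrictSet_eq_neg_slice hdX h0X (sf_contDiff c).continuous s,
    Current.mass_neg] at key
  exact key

/-- **Integrated slice-mass bound** (the slicing inequality [Federer1969, 4.2.1] for the cycle
`X = [T]|B(c,t₂)` and `f = -‖· - c‖²`, `‖Df‖ ≤ 2t₂` on the ball, where `‖X‖` lives):
`∫_{s ∈ (a,b)} 𝐌⟨X, f, s+⟩ ds ≤ C_{2q+1} · 2t₂ · ∫_{reg|T| ∩ B̄(c,t₂)} |θ_T|`.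
[cite: Federer1969, 4.2.1] -/
private theorem lintegral_mass_slice_le (hB : closedBall c t₂ ⊆ (Ω : Set V)) (a b : ℝ)
    (hX : letI : InnerProductSpace ℝ V := InnerProductSpace.complexToReal
      (T.cut c t₂).IsRepresentable)
    (hdX : letI : InnerProductSpace ℝ V := InnerProductSpace.complexToReal
      (Current.boundary (T.cut c t₂)).IsRepresentable) :
    letI : InnerProductSpace ℝ V := InnerProductSpace.complexToReal
    ∫⁻ s in Ioo a b, (hX.slice hdX (sf_contDiff c).continuous s).mass ≤
      ENNReal.ofReal (sliceConst (2 * q + 1)) * (ENNReal.ofReal (2 * t₂) *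
        ∫⁻ x in T.carrier ∩ closedBall c t₂, ‖(T.density x : ℝ)‖ₑ ∂(μHE[2 * (q + 1)] : Measure V)) := by
  letI : InnerProductSpace ℝ V := InnerProductSpace.complexToReal
  haveI : FiniteDimensional ℝ V := FiniteDimensional.complexToReal V
  obtain ⟨-, -, hXmass⟩ := T.cut_spec hB
  -- `‖Df‖ ≤ 2 t₂` where `‖X‖` lives
  have hvar : ∀ᵐ x ∂(T.cut c t₂).variation, x ∈ ((U₀ c t₂ : Opens V) : Set V) := by
    have h := (T.cut c t₂).variation_compl
    rw [measure_eq_zero_iff_ae_notMem] at h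
    filter_upwards [h] with x hx using not_notMem.1 hx
  have hDf : ∫⁻ x in sf c ⁻¹' Icc a (b + 1), ‖fderiv ℝ (sf c) x‖ₑ ∂(T.cut c t₂).variation ≤
      ENNReal.ofReal (2 * t₂) * (T.cut c t₂).mass :=
    calc ∫⁻ x in sf c ⁻¹' Icc a (b + 1), ‖fderiv ℝ (sf c) x‖ₑ ∂(T.cut c t₂).variation
        ≤ ∫⁻ x, ‖fderiv ℝ (sf c) x‖ₑ ∂(T.cut c t₂).variation := setLIntegral_le_lintegral _ _
      _ ≤ ∫⁻ _, ENNReal.ofReal (2 * t₂) ∂(T.cut c t₂).variation := by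
          refine lintegral_mono_ae (hvar.mono fun x hx => ?_)
          rw [← ofReal_norm, norm_fderiv_sf]
          have hx' : ‖x - c‖ < t₂ := mem_ball_iff_norm.1 hx
          exact ENNReal.ofReal_le_ofReal (by linarith)
      _ = ENNReal.ofReal (2 * t₂) * (T.cut c t₂).variation univ := lintegral_const _
      _ ≤ ENNReal.ofReal (2 * t₂) * (T.cut c t₂).mass := by gcongr; exact (T.cut c t₂).variation_le_mass _
  calc ∫⁻ s in Ioo a b, (hX.slice hdX (sf_contDiff c).continuous s).mass
      ≤ ENNReal.ofReal (sliceConst (2 * q + 1)) *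
          ∫⁻ x in sf c ⁻¹' Icc a (b + 1), ‖fderiv ℝ (sf c) x‖ₑ ∂(T.cut c t₂).variation :=
        hX.lintegral_mass_slice_le hdX (sf_contDiff c) a b one_pos
    _ ≤ ENNReal.ofReal (sliceConst (2 * q + 1)) * (ENNReal.ofReal (2 * t₂) * (T.cut c t₂).mass) := by
        gcongr
    _ ≤ _ := by gcongr

/-- **The ball piece is integral for almost every radius**: for a.e. `s ∈ (-t₂², 0)` the boundary
of `T.piece c √(-s)` is the rectifiable current of the sphere slice data of `[T]`
(`ae_exists_sphereSliceData`). [cite: Federer1969, 4.2.16; Harvey1977, Lemma 1.8] -/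
theorem ae_isIntegral_piece (ht₂ : 0 < t₂) (hB : closedBall c t₂ ⊆ (Ω : Set V)) :
    letI : InnerProductSpace ℝ V := InnerProductSpace.complexToReal
    ∀ᵐ s : ℝ, s ∈ Ioo (-t₂ ^ 2) 0 →
      (T.piece c (Real.sqrt (-s)) : Current (⊤ : Opens V) (2 * q + 1 + 1)).IsIntegral := by
  letI : InnerProductSpace ℝ V := InnerProductSpace.complexToReal
  haveI : FiniteDimensional ℝ V := FiniteDimensional.complexToReal V
  filter_upwards [T.ae_exists_sphereSliceData ht₂ hB] with s hs hsI
  obtain ⟨θ, ν, hdata, -, hbd⟩ := hs hsI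
  have hρt : Real.sqrt (-s) < t₂ := by rw [Real.sqrt_lt' ht₂]; linarith [hsI.1]
  have hBρ : closedBall c (Real.sqrt (-s)) ⊆ (Ω : Set V) :=
    (closedBall_subset_closedBall hρt.le).trans hB
  refine ⟨T.isRectifiable_piece hBρ, ?_⟩
  have hb : Current.boundary (T.piece c (Real.sqrt (-s)) : Current (⊤ : Opens V) (2 * q + 1 + 1)) =
      currentOfIntegration (T.carrier ∩ sphere c (Real.sqrt (-s))) θ ν := hbd ⊤
  rw [hb]
  exact ⟨⟨_, _, _, hdata, rfl⟩, Current.isCompact_support_of_subset _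
    (isCompact_sphere c (Real.sqrt (-s))) (subset_univ _)
    ((support_currentOfIntegration_subset_closure _ _ _).trans
      (closure_minimal inter_subset_right isClosed_sphere))⟩

/-- **A good radius: an integral ball piece with controlled boundary mass.** If
`∫_{reg|T| ∩ B̄(c,t₂)} |θ_T| ≤ M < ∞` and `0 < ρ₁ < ρ₂ < t₂`, then for some `ρ ∈ (ρ₁, ρ₂)` the piece
`T.piece c ρ` is an integral current with
`𝐌(∂ piece) ≤ (C_{2q+1} · 2t₂ · M + 1) / (ρ₂² - ρ₁²)` (Chebyshev on the conull set of radii with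
rectifiable sphere slices). [cite: Federer1969, 4.2.1, 4.2.16; Chirka1989, §16.1, p. 207] -/
theorem exists_piece_isIntegral_mass_boundary_le (ht₂ : 0 < t₂) (hB : closedBall c t₂ ⊆ (Ω : Set V))
    {ρ₁ ρ₂ : ℝ} (h0 : 0 < ρ₁) (h12 : ρ₁ < ρ₂) (h2 : ρ₂ < t₂) {M : ℝ≥0∞} (hMtop : M ≠ ⊤)
    (hM : ∫⁻ x in T.carrier ∩ closedBall c t₂, ‖(T.density x : ℝ)‖ₑ ∂(μHE[2 * (q + 1)] : Measure V)
      ≤ M) :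
    letI : InnerProductSpace ℝ V := InnerProductSpace.complexToReal
    ∃ ρ ∈ Ioo ρ₁ ρ₂, (T.piece c ρ : Current (⊤ : Opens V) (2 * q + 1 + 1)).IsIntegral ∧
      (Current.boundary (T.piece c ρ : Current (⊤ : Opens V) (2 * q + 1 + 1))).mass ≤
        (ENNReal.ofReal (sliceConst (2 * q + 1)) * (ENNReal.ofReal (2 * t₂) * M) + 1) /
          ENNReal.ofReal (ρ₂ ^ 2 - ρ₁ ^ 2) := by
  letI : InnerProductSpace ℝ V := InnerProductSpace.complexToReal
  haveI : FiniteDimensional ℝ V := FiniteDimensional.complexToReal V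
  -- the cycle `X = [T]|B(c,t₂)`
  obtain ⟨hd₀, h0X, -⟩ := T.cut_spec hB
  have hX : (T.cut c t₂).IsRepresentable := hd₀.isRepresentable
  have hdX : (Current.boundary (T.cut c t₂)).IsRepresentable := by
    rw [h0X]; exact Current.isRepresentable_zero
  -- the level interval
  set a : ℝ := -(ρ₂ ^ 2) with ha
  set b : ℝ := -(ρ₁ ^ 2) with hb
  have hab : a < b := by rw [ha, hb]; nlinarith
  have hsub : Ioo a b ⊆ Ioo (-t₂ ^ 2) 0 := fun s hs =>
    ⟨by rw [ha] at hs; nlinarith [hs.1], by rw [hb] at hs; nlinarith [hs.2]⟩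
  set g : ℝ → ℝ≥0∞ := fun s => (hX.slice hdX (sf_contDiff c).continuous s).mass with hg
  -- the integral bound `∫_{(a,b)} g ≤ B`
  set B : ℝ≥0∞ := ENNReal.ofReal (sliceConst (2 * q + 1)) * (ENNReal.ofReal (2 * t₂) * M)
    with hBdef
  have hBtop : B ≠ ⊤ := ENNReal.mul_ne_top ENNReal.ofReal_ne_top
    (ENNReal.mul_ne_top ENNReal.ofReal_ne_top hMtop)
  have hgint : ∫⁻ s in Ioo a b, g s ≤ B :=
    (T.lintegral_mass_slice_le hB a b hX hdX).trans (by rw [hBdef]; gcongr)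
  -- the good set of levels is conull
  have hgood : ∀ᵐ s : ℝ, s ∈ Ioo a b →
      (T.piece c (Real.sqrt (-s)) : Current (⊤ : Opens V) (2 * q + 1 + 1)).IsIntegral ∧
        (Current.boundary (T.piece c (Real.sqrt (-s)) :
          Current (⊤ : Opens V) (2 * q + 1 + 1))).mass ≤ g s := by
    filter_upwards [T.ae_isIntegral_piece ht₂ hB] with s hs hsab
    exact ⟨hs (hsub hsab), T.mass_boundary_piece_le_mass_slice ht₂ hB (hsub hsab) hX hdX h0X⟩
  -- Chebyshev: some good level has `g s ≤ (B + 1)/(b - a)`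
  set lam : ℝ≥0∞ := (B + 1) / ENNReal.ofReal (b - a) with hlam
  have hlen0 : ENNReal.ofReal (b - a) ≠ 0 := by
    rw [ne_eq, ENNReal.ofReal_eq_zero, not_le]; linarith
  have hlen : lam * ENNReal.ofReal (b - a) = B + 1 := by
    rw [hlam, ENNReal.div_mul_cancel hlen0 ENNReal.ofReal_ne_top]
  have hex : ∃ s ∈ Ioo a b,
      ((T.piece c (Real.sqrt (-s)) : Current (⊤ : Opens V) (2 * q + 1 + 1)).IsIntegral ∧
        (Current.boundary (T.piece c (Real.sqrt (-s)) :
          Current (⊤ : Opens V) (2 * q + 1 + 1))).mass ≤ g s) ∧ g s ≤ lam := by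
    by_contra hcon
    push Not at hcon
    have hae : ∀ᵐ s : ℝ, s ∈ Ioo a b → lam ≤ g s := by
      filter_upwards [hgood] with s hs hsab
      exact (hcon s hsab (hs hsab)).le
    have hge : ∫⁻ _ in Ioo a b, lam ≤ ∫⁻ s in Ioo a b, g s :=
      setLIntegral_mono_ae' measurableSet_Ioo hae
    rw [setLIntegral_const, Real.volume_Ioo, hlen] at hge
    have := hge.trans hgint
    exact absurd this (by rw [not_le]; exact ENNReal.lt_add_right hBtop one_ne_zero)
  obtain ⟨s, hsab, ⟨hI, hbdle⟩, hgs⟩ := hex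
  -- the radius `ρ = √(-s) ∈ (ρ₁, ρ₂)`
  refine ⟨Real.sqrt (-s), ⟨?_, ?_⟩, hI, ?_⟩
  · rw [Real.lt_sqrt h0.le]; rw [hb] at hsab; linarith [hsab.2]
  · rw [Real.sqrt_lt' (h0.trans h12)]; rw [ha] at hsab; linarith [hsab.1]
  · have hba : ρ₂ ^ 2 - ρ₁ ^ 2 = b - a := by rw [ha, hb]; ring
    rw [hba]
    exact hbdle.trans hgs

end Boundary

/-! ### The sequence form -/

/-- **Uniformly normal integral ball pieces along a sequence of holomorphic chains**
[Chirka1989, §16.1 Prop. 1 (proof), p. 207, "the local uniform boundedness of the masses"]: let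
`T_j` be holomorphic `p`-chains (`p = q + 1`) on `Ω ⊇ B̄(c,t₂)` with
`∫_{reg|T_j| ∩ B̄(c,t₂)} |θ_{T_j}| d𝓗^{2p} ≤ M < ∞` for all `j`, and `0 < ρ₁ < ρ₂ < t₂`. Then there are
radii `ρ_j ∈ (ρ₁, ρ₂)` such that every `T_j.piece c ρ_j` is an INTEGRAL current on `V` supported
in `B̄(c, ρ₂)`, of normal mass `𝐍 ≤ M + (C_{2q+1} · 2t₂ · M + 1)/(ρ₂² - ρ₁²)`, agreeing with `[T_j]`
on the test forms supported in `B(c, ρ₁)`. [cite: Chirka1989, §16.1 Prop. 1, p. 207; Federer1969, 4.2.17] -/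
theorem exists_seq_piece_isIntegral (T : ℕ → HolomorphicChain 𝓘(ℂ, V) Ω (q + 1)) {c : V} {t₂ : ℝ}
    (ht₂ : 0 < t₂) (hB : closedBall c t₂ ⊆ (Ω : Set V)) {ρ₁ ρ₂ : ℝ} (h0 : 0 < ρ₁) (h12 : ρ₁ < ρ₂)
    (h2 : ρ₂ < t₂) {M : ℝ≥0∞} (hMtop : M ≠ ⊤)
    (hM : ∀ j, ∫⁻ x in (T j).carrier ∩ closedBall c t₂, ‖((T j).density x : ℝ)‖ₑ
      ∂(μHE[2 * (q + 1)] : Measure V) ≤ M) :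
    letI : InnerProductSpace ℝ V := InnerProductSpace.complexToReal
    ∃ ρ : ℕ → ℝ, ∀ j, ρ j ∈ Ioo ρ₁ ρ₂ ∧
      ((T j).piece c (ρ j) : Current (⊤ : Opens V) (2 * q + 1 + 1)).IsIntegral ∧
      ((T j).piece c (ρ j)).support ⊆ closedBall c ρ₂ ∧
      ((T j).piece c (ρ j) : Current (⊤ : Opens V) (2 * q + 1 + 1)).normalMass ≤
        M + (ENNReal.ofReal (sliceConst (2 * q + 1)) * (ENNReal.ofReal (2 * t₂) * M) + 1) /
          ENNReal.ofReal (ρ₂ ^ 2 - ρ₁ ^ 2) ∧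
      ∀ ψ : TestForm Ω (2 * (q + 1)), tsupport ⇑ψ ⊆ ball c ρ₁ →
        (T j).piece c (ρ j) (TestFunction.monoCLM ℝ ψ) = (T j).toCurrent ψ := by
  letI : InnerProductSpace ℝ V := InnerProductSpace.complexToReal
  have h : ∀ j, ∃ ρ ∈ Ioo ρ₁ ρ₂,
      ((T j).piece c ρ : Current (⊤ : Opens V) (2 * q + 1 + 1)).IsIntegral ∧
      (Current.boundary ((T j).piece c ρ : Current (⊤ : Opens V) (2 * q + 1 + 1))).mass ≤
        (ENNReal.ofReal (sliceConst (2 * q + 1)) * (ENNReal.ofReal (2 * t₂) * M) + 1) /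
          ENNReal.ofReal (ρ₂ ^ 2 - ρ₁ ^ 2) := fun j =>
    (T j).exists_piece_isIntegral_mass_boundary_le ht₂ hB h0 h12 h2 hMtop (hM j)
  choose ρ hρ hI hbd using h
  refine ⟨ρ, fun j => ⟨hρ j, hI j, ?_, ?_, fun ψ hψ => ?_⟩⟩
  · exact ((T j).support_piece_subset c (ρ j)).trans (closedBall_subset_closedBall (hρ j).2.le)
  · unfold Current.normalMass
    exact add_le_add (((T j).mass_piece_le ((hρ j).2.le.trans h2.le) hB).trans (hM j)) (hbd j)
  · exact (T j).piece_monoCLM_apply ((closedBall_subset_closedBall ((hρ j).2.le.trans h2.le)).trans hB)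
      ψ (hψ.trans (ball_subset_ball (hρ j).1.le))

end HolomorphicChain

end Literature.Geometry.Kaehler

end
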